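import Mathlib.LinearAlgebra.Eigenspace.Semisimple
import Mathlib.LinearAlgebra.Eigenspace.Minpoly
import Mathlib.Data.Int.Log
import Mathlib.Analysis.Complex.Polynomial.Basic
import Mathlib.Algebra.DirectSum.Module
import Mathlib.Order.CompactlyGenerated.Basic
import HarnessLib

/-!
# Generic Weil–Deligne representations form one orbit, I: the eigen-grading

Linear-algebra tools for the discharge (`GenericWeilDeligneOrbitProofs`) of the named fact
`WeilDeligneRep.AHTW2026_prop_6_0_5_generic_conj` (A'Campo–Hevesi–Thorne–Whitmore,
arXiv:2607.11763, Prop. 6.0.5 (1)–(2) with Def. 6.0.4; file `GenericWeilDeligneOrbit`), all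
proved:

* `int_log_base_mul` — `Int.log b (b r) = Int.log b r + 1`;
* `exists_eigenGrading` — for a semisimple injective endomorphism `S` of a finite-dimensional
  complex space and an integer `Q ≥ 2`, grouping the eigenspaces `E_μ` by `⌊log_Q ‖μ‖⌋` gives a
  finite grading `V = ⨁ gr k` preserved by the commutant of `S`, raised by one by every `B` with
  `S B = Q B S` and lowered by one by every `B` with `B S = Q S B` (for a Weil–Deligne
  representation and `S = ρ(Φᵐ)` a central Frobenius power, `Q = qᵐ`: `N` raises, the maps
  `f` of `Hom_WD((r,N),(r(1),N))` lower the degree);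
* `exists_blockScalar` — operators acting by a scalar on each piece of an internal direct sum;
* `linearMap_eq_of_eq_on_iSup` — extensionality along an exhaustive family of submodules.

## References

* L. A'Campo, B. Hevesi, J. A. Thorne, D. Whitmore, *Local-global compatibility of automorphic
  Galois representations over CM fields at p*, arXiv:2607.11763 (2026), §6. [AHTW2026]
-/

namespace Literature.NumberTheory.GaloisRepresentations

namespace WeilDeligneRep

open Module

/-- `Int.log b (b * r) = Int.log b r + 1` for `b > 1`, `r > 0`. [folklore] -/
theorem int_log_base_mul {b : ℕ} (hb : 1 < b) {r : ℝ} (hr : 0 < r) :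
    Int.log b ((b : ℝ) * r) = Int.log b r + 1 := by
  have hb0 : (0 : ℝ) < b := by exact_mod_cast (zero_lt_one.trans hb)
  refine le_antisymm ?_ ?_
  · have h1 := (Int.zpow_le_iff_le_log hb (mul_pos hb0 hr)).mpr le_rfl
    have h2 : (b : ℝ) ^ (Int.log b ((b : ℝ) * r) - 1) ≤ r := by
      rw [zpow_sub_one₀ hb0.ne']
      calc (b : ℝ) ^ Int.log b ((b : ℝ) * r) * (b : ℝ)⁻¹
          ≤ ((b : ℝ) * r) * (b : ℝ)⁻¹ := mul_le_mul_of_nonneg_right h1 (inv_nonneg.mpr hb0.le)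
        _ = r := by field_simp
    have h3 := (Int.zpow_le_iff_le_log hb hr).mp h2
    omega
  · have h1 := (Int.zpow_le_iff_le_log hb hr).mpr le_rfl
    have h2 : (b : ℝ) ^ (Int.log b r + 1) ≤ (b : ℝ) * r := by
      rw [zpow_add_one₀ hb0.ne', mul_comm]
      exact mul_le_mul_of_nonneg_left h1 hb0.le
    exact (Int.zpow_le_iff_le_log hb (mul_pos hb0 hr)).mp h2

/-- **The eigen-grading of a semisimple automorphism under `Q`-scaling.**  Let `S` be a
semisimple injective endomorphism of a finite-dimensional complex vector space `V` and `Q ≥ 2`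
an integer.  Grouping the eigenspaces `E_μ` of `S` according to the integer part of
`log_Q ‖μ‖` gives a finite grading `V = ⨁_{k < Nb} gr k` by sums of eigenspaces such that every
endomorphism commuting with `S` preserves each `gr k`, every `B` with `S B = Q • B S` raises the
degree by one, and every `B` with `B S = Q • S B` lowers it by one (killing `gr 0`).
[folklore] -/
theorem exists_eigenGrading {V : Type*} [AddCommGroup V] [Module ℂ V] [FiniteDimensional ℂ V]
    (S : Module.End ℂ V) (hS : S.IsSemisimple) (hSinj : Function.Injective S) {Q : ℕ} (hQ : 1 < Q) :
    ∃ (gr : ℕ → Submodule ℂ V) (Nb : ℕ),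
      iSupIndep gr ∧ (⨆ k, gr k) = ⊤ ∧ (∀ k, Nb ≤ k → gr k = ⊥) ∧
      (∀ μ, ∃ k, S.eigenspace μ ≤ gr k) ∧
      (∀ A : V →ₗ[ℂ] V, A ∘ₗ S = S ∘ₗ A → ∀ k, ∀ x ∈ gr k, A x ∈ gr k) ∧
      (∀ B : V →ₗ[ℂ] V, S ∘ₗ B = (Q : ℂ) • (B ∘ₗ S) → ∀ k, ∀ x ∈ gr k, B x ∈ gr (k + 1)) ∧
      (∀ B : V →ₗ[ℂ] V, B ∘ₗ S = (Q : ℂ) • (S ∘ₗ B) →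
        (∀ x ∈ gr 0, B x = 0) ∧ ∀ k, ∀ x ∈ gr (k + 1), B x ∈ gr k) := by
  classical
  set E : ℂ → Submodule ℂ V := fun μ => S.eigenspace μ with hE
  have hind0 : iSupIndep E := S.eigenspaces_iSupIndep
  have hsup0 : ⨆ μ, E μ = ⊤ := hS.iSup_eigenspace_eq_top
  have hQ0 : (0 : ℝ) < Q := by exact_mod_cast (zero_lt_one.trans hQ)
  have hQC : (Q : ℂ) ≠ 0 := by exact_mod_cast (zero_lt_one.trans hQ).ne'
  have hmemE : ∀ (μ : ℂ) (x : V), x ∈ E μ ↔ S x = μ • x := fun μ x =>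
    Module.End.mem_eigenspace_iff
  -- the degree of an eigenvalue
  let d : ℂ → ℤ := fun μ => Int.log Q ‖μ‖
  have hd_mul : ∀ μ : ℂ, μ ≠ 0 → d ((Q : ℂ) * μ) = d μ + 1 := by
    intro μ hμ
    change Int.log Q ‖(Q : ℂ) * μ‖ = Int.log Q ‖μ‖ + 1
    rw [norm_mul, Complex.norm_natCast]
    exact int_log_base_mul hQ (norm_pos_iff.mpr hμ)
  have hd_div : ∀ μ : ℂ, μ ≠ 0 → d (μ / (Q : ℂ)) = d μ - 1 := by
    intro μ hμ
    have := hd_mul (μ / (Q : ℂ)) (div_ne_zero hμ hQC)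
    rw [mul_div_cancel₀ _ hQC] at this
    omega
  -- eigenvalues are non-zero, finitely many
  have hE0 : ∀ μ : ℂ, E μ ≠ ⊥ → μ ≠ 0 := by
    intro μ hμ h0
    apply hμ
    change S.eigenspace μ = ⊥
    rw [h0, Module.End.eigenspace_zero, LinearMap.ker_eq_bot]
    exact hSinj
  have hfin : Set.Finite {μ : ℂ | E μ ≠ ⊥} := S.finite_hasEigenvalue
  obtain ⟨d₀, hd₀⟩ := (hfin.image d).bddBelow
  obtain ⟨d₁, hd₁⟩ := (hfin.image d).bddAbove
  have hd₀' : ∀ μ, E μ ≠ ⊥ → d₀ ≤ d μ := fun μ hμ => hd₀ ⟨μ, hμ, rfl⟩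
  have hd₁' : ∀ μ, E μ ≠ ⊥ → d μ ≤ d₁ := fun μ hμ => hd₁ ⟨μ, hμ, rfl⟩
  -- the grading
  let gr : ℕ → Submodule ℂ V := fun k => ⨆ μ ∈ {μ : ℂ | d μ = d₀ + k}, E μ
  have hgr_le : ∀ μ (k : ℕ), d μ = d₀ + k → E μ ≤ gr k := fun μ k h =>
    le_iSup₂_of_le (f := fun μ (_ : μ ∈ {μ : ℂ | d μ = d₀ + k}) => E μ) μ h le_rfl
  have hE_le : ∀ μ (k : ℕ), (E μ ≠ ⊥ → d μ = d₀ + k) → E μ ≤ gr k := by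
    intro μ k h
    by_cases hμ : E μ = ⊥
    · rw [hμ]; exact bot_le
    · exact hgr_le μ k (h hμ)
  -- a degreewise statement is checked on eigenvectors
  have hgr_ind : ∀ (k : ℕ) (P : V → Prop), (∀ μ, d μ = d₀ + k → ∀ x ∈ E μ, P x) → P 0 →
      (∀ x y, P x → P y → P (x + y)) → ∀ x ∈ gr k, P x := by
    intro k P hP h0 hadd x hx
    refine Submodule.iSup_induction _ (motive := P) hx ?_ h0 hadd
    intro μ y hy
    by_cases hμ : d μ = d₀ + k
    · rw [iSup_pos (show μ ∈ {μ : ℂ | d μ = d₀ + k} from hμ)] at hy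
      exact hP μ hμ y hy
    · rw [iSup_neg (show μ ∉ {μ : ℂ | d μ = d₀ + k} from hμ), Submodule.mem_bot] at hy
      rw [hy]; exact h0
  refine ⟨gr, (d₁ - d₀ + 1).toNat, ?_, ?_, ?_, ?_, ?_, ?_, ?_⟩
  rotate_left 3
  · -- every eigenspace lies in some piece
    intro μ
    by_cases hμ : E μ = ⊥
    · exact ⟨0, by change E μ ≤ gr 0; rw [hμ]; exact bot_le⟩
    · refine ⟨(d μ - d₀).toNat, hgr_le μ _ ?_⟩
      have := hd₀' μ hμ
      omega
  rotate_right 3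
  · -- independence
    rw [iSupIndep_def]
    intro i
    have h1 : (⨆ (j) (_ : j ≠ i), gr j) ≤ ⨆ μ ∈ {μ : ℂ | d μ ≠ d₀ + i}, E μ := by
      refine iSup₂_le fun j hj => iSup₂_le fun μ hμ => ?_
      refine le_iSup₂_of_le (f := fun μ (_ : μ ∈ {μ : ℂ | d μ ≠ d₀ + i}) => E μ) μ ?_ le_rfl
      change d μ = d₀ + j at hμ
      change d μ ≠ d₀ + i
      rw [hμ]; omega
    refine Disjoint.mono_right h1 ?_
    exact hind0.disjoint_biSup_biSup (Set.disjoint_left.mpr fun μ h1 h2 => h2 h1)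
  · -- exhaustive
    rw [eq_top_iff, ← hsup0]
    refine iSup_le fun μ => ?_
    by_cases hμ : E μ = ⊥
    · rw [hμ]; exact bot_le
    · have h1 := hd₀' μ hμ
      refine le_iSup_of_le (d μ - d₀).toNat (hgr_le μ _ ?_)
      omega
  · -- bounded
    intro k hk
    rw [Submodule.eq_bot_iff]
    refine hgr_ind k (fun x => x = 0) (fun μ hμ x hx => ?_) rfl (fun x y hx hy => by
      rw [hx, hy, add_zero])
    by_contra hx0
    have hne : E μ ≠ ⊥ := fun h => hx0 (by rw [h, Submodule.mem_bot] at hx; exact hx)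
    have := hd₁' μ hne
    omega
  · -- commuting endomorphisms preserve the grading
    intro A hA k
    refine hgr_ind k (fun x => A x ∈ gr k) (fun μ hμ x hx => ?_) (by rw [map_zero]; exact zero_mem _)
      (fun x y hx hy => by rw [map_add]; exact add_mem hx hy)
    apply hgr_le μ k hμ
    rw [hmemE] at hx ⊢
    rw [← LinearMap.comp_apply, ← hA, LinearMap.comp_apply, hx, map_smul]
  · -- `S B = Q B S`: `B` raises the degree
    intro B hB k
    refine hgr_ind k (fun x => B x ∈ gr (k + 1)) (fun μ hμ x hx => ?_)
      (by rw [map_zero]; exact zero_mem _) (fun x y hx hy => by rw [map_add]; exact add_mem hx hy)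
    have hBx : B x ∈ E ((Q : ℂ) * μ) := by
      rw [hmemE] at hx ⊢
      rw [← LinearMap.comp_apply, hB, LinearMap.smul_apply, LinearMap.comp_apply, hx, map_smul,
        smul_smul]
    by_cases hμ0 : μ = 0
    · have : x = 0 := by
        rw [hμ0] at hx
        have h := hE0 0
        by_contra hx0
        exact h (fun h0 => hx0 (by rw [h0, Submodule.mem_bot] at hx; exact hx)) rfl
      rw [this, map_zero]; exact zero_mem _
    · refine hgr_le _ (k + 1) ?_ hBx
      rw [hd_mul μ hμ0, hμ]; push_cast; ring
  · -- `B S = Q S B`: `B` lowers the degree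
    intro B hB
    have hBx : ∀ μ, ∀ x ∈ E μ, B x ∈ E (μ / (Q : ℂ)) := by
      intro μ x hx
      rw [hmemE] at hx ⊢
      have h1 : B (S x) = (Q : ℂ) • S (B x) := by
        rw [← LinearMap.comp_apply, hB]; rfl
      rw [hx, map_smul] at h1
      have h2 : S (B x) = (Q : ℂ)⁻¹ • (μ • B x) := by
        rw [h1, smul_smul, inv_mul_cancel₀ hQC, one_smul]
      rw [h2, smul_smul, div_eq_inv_mul]
    have hzero : ∀ μ, d μ = d₀ → ∀ x ∈ E μ, B x = 0 := by
      intro μ hμ x hx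
      by_cases hμ0 : μ = 0
      · have : x = 0 := by
          rw [hμ0] at hx
          by_contra hx0
          exact hE0 0 (fun h0 => hx0 (by rw [h0, Submodule.mem_bot] at hx; exact hx)) rfl
        rw [this, map_zero]
      · have h1 := hBx μ x hx
        by_contra hne
        have hne' : E (μ / (Q : ℂ)) ≠ ⊥ := fun h => hne (by rw [h, Submodule.mem_bot] at h1; exact h1)
        have h2 := hd₀' _ hne'
        rw [hd_div μ hμ0] at h2
        omega
    refine ⟨?_, ?_⟩
    · refine hgr_ind 0 (fun x => B x = 0) (fun μ hμ x hx => hzero μ (by simpa using hμ) x hx)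
        (map_zero B) (fun x y hx hy => by rw [map_add, hx, hy, add_zero])
    · intro k
      refine hgr_ind (k + 1) (fun x => B x ∈ gr k) (fun μ hμ x hx => ?_)
        (by rw [map_zero]; exact zero_mem _) (fun x y hx hy => by rw [map_add]; exact add_mem hx hy)
      by_cases hμ0 : μ = 0
      · have : x = 0 := by
          rw [hμ0] at hx
          by_contra hx0
          exact hE0 0 (fun h0 => hx0 (by rw [h0, Submodule.mem_bot] at hx; exact hx)) rfl
        rw [this, map_zero]; exact zero_mem _
      · refine hgr_le _ k ?_ (hBx μ x hx)
        rw [hd_div μ hμ0, hμ]; push_cast; ring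

/-- **Block-scalar operators.**  For an internal direct sum decomposition `V = ⨁ gr k` and
scalars `c k`, there is an endomorphism acting on `gr k` as `c k`. [folklore] -/
theorem exists_blockScalar {V : Type*} [AddCommGroup V] [Module ℂ V] (gr : ℕ → Submodule ℂ V)
    (h : DirectSum.IsInternal gr) (c : ℕ → ℂ) :
    ∃ D : V →ₗ[ℂ] V, ∀ k, ∀ x ∈ gr k, D x = c k • x := by
  classical
  let e := LinearEquiv.ofBijective (DirectSum.coeLinearMap gr) h
  refine ⟨(DirectSum.toModule ℂ ℕ V fun k => c k • (gr k).subtype) ∘ₗ e.symm.toLinearMap,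
    fun k x hx => ?_⟩
  have h1 : e.symm x = DirectSum.lof ℂ ℕ (fun k => gr k) k ⟨x, hx⟩ := by
    rw [LinearEquiv.symm_apply_eq]
    change x = DirectSum.coeLinearMap gr _
    rw [DirectSum.coeLinearMap_lof]
  rw [LinearMap.comp_apply, LinearEquiv.coe_toLinearMap, h1, DirectSum.toModule_lof]
  rfl

/-- Two linear maps agreeing on every piece of an exhaustive family of submodules are equal.
[folklore] -/
theorem linearMap_eq_of_eq_on_iSup {R₁ : Type*} [Semiring R₁] {V W : Type*} [AddCommMonoid V]
    [Module R₁ V] [AddCommMonoid W] [Module R₁ W] {ι : Type*} (gr : ι → Submodule R₁ V)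
    (hsup : ⨆ k, gr k = ⊤) (f g : V →ₗ[R₁] W) (h : ∀ k, ∀ x ∈ gr k, f x = g x) : f = g := by
  ext x
  have hx : x ∈ ⨆ k, gr k := hsup ▸ Submodule.mem_top
  refine Submodule.iSup_induction gr (motive := fun x => f x = g x) hx h (by simp) ?_
  intro x y hx hy; rw [map_add, map_add, hx, hy]

end WeilDeligneRep

end Literature.NumberTheory.GaloisRepresentations
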